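import Mathlib
import Literature.Computability.Complexity.BoolEncodings
import Literature.Computability.Complexity.Oracle
import Literature.Computability.Cryptography.OracleGames
import Literature.Computability.Cryptography.EncryptionSchemes
import Literature.Computability.Cryptography.CommitmentsSignatures
import HarnessLib

/-!
# The approximate-hidden-coset oracle and the class `BPP^AHC`

Vocabulary requested by route `QuantumAdvantage/BochnerSampling` to type its crux `FH2Necessity`
(`BPP^FS ⊆ BPP^AHC`). A *Fourier-sampling instance* is `f : {0,1}^m → {0,1}^*` with a register
tag `(ℤ/2)^m` or `ℤ/2^m`; the standard method (superpose, one query, measure the value register,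
QFT over the register group, measure) samples the *Fourier-sampling law*
`D_f(c) = |G|⁻² ∑_{y,y'} [f y = f y'] χ_c(y − y')` [de Wolf 2019, §6.2.2; Shi 2005, §4 (`FH₂`)]:
uniform on `H^⊥` when `f` hides the subgroup `H`, a Fejér comb on a rank-one Bohr set for a
period not dividing `2^m`.

The **approximate-hidden-coset (AHC) oracle** answers `⟨s, ⟨1^K, ⟨1^e, ⟨1^d, ⟨1^L, 1^R⟩⟩⟩⟩⟩`
(`s` an instance query, parameters in unary, `ε = 1/e`, `δ = 1/d`) by
* the symbol `⊥`, surely, if `D_f` is **not** `(K, ε)`-flat (`IsFlatLaw`: mass `≥ 1 − ε` on some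
  `T`, no atom above `K/|T|` — verbatim the hypothesis of route items `FlatLawRigidity[Cyclic]`);
* ONE SAMPLE of a *fixed* structured law `M` with `‖M − D_f‖₁ ≤ δ` if `D_f` is flat: a mixture of
  at most `L` uniform laws on cosets `c_i + W_i` of subgroups of `(ℤ/2)^m` (`IsCosetMixture`),
  resp. on shifted Bohr sets `c_i + Bohr(Γ_i, ρ_i)` of rank `≤ R` in `ℤ/2^m` (`IsBohrMixture`) —
  verbatim the conclusions of `FlatLawRigidity` / `FlatLawRigidityCyclic`;
* anything, where a flat law admits no such `M` (a case the rigidity cruxes assert empty for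
  `ε ≤ ε(K,δ)`, `L ≥ L(K,δ)`, `R ≥ R(K,δ)`): the oracle is a RELATION, and a machine "with the
  AHC oracle" must be correct against EVERY conforming oracle [Goldreich 2006, §1.2, Def. 3].
`BPPAHCWith Q` is bounded-error probabilistic polynomial time with such an oracle (the tree's
transcript machines `OracleAdversary` run against a probabilistic oracle, `probOutputPMF`), for a
presentation `Q : FSQueryCode` of instances by query strings; `BPPAHC` fixes the self-contained
presentation `nandQueryCode` (multi-output NAND straight-line programs, `m` in unary).

## Design notes

* The component bound `L` is essential: every law is a mixture of point masses = uniform laws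
  on cosets of the trivial subgroup (`isCosetMixture_dirac`); unary parameters stay polynomial.
* `D_f`, flatness and the structured laws are the SAME real formulas as in the route items; the
  sampled law is a genuine `PMF` `ν` with `(ν c).toReal = M c`. Bohr sets use the route's
  non-strict `|(γ (c − c₀)).valMinAbs| ≤ ρ N` (Tao–Vu: `‖γ·x‖_{ℝ/ℤ} < ρ` [Tao–Vu 2006, Def. 4.17]).
* Bits: `(ℤ/2)^m ∋ y ↦ (i ↦ [y i = 1])`, `ℤ/2^m ∋ y ↦ (i ↦ testBit y.val i)` (little-endian);
  answers `(encodingBitVec m).optionBool` (`⊥ ↦ [false]`, `c ↦ true :: c`, length `≤ m + 1`).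
* `Q : FSQueryCode` is a parameter because the companion class `BPPFS` (requested separately)
  must use the same instance queries: instantiate `Q` with its decoder.
* Not here: `BPPFS`, its calibration `BPPFS ⊆ BQP`, and any claim about `FH2Necessity`.
-/

namespace Literature.Computability.QuantumComplexity

open _root_.Computability Literature.Computability.Complexity Literature.Computability.Cryptography Finset

/-! ### Fourier-sampling laws of the standard method -/

/-- The Fourier-sampling law over the Boolean cube, `D_f(c) = 4^{-m} ∑_{y,y'} [f y = f y']
(-1)^{c·(y-y')}`: the output law of the standard method (Hadamards, one query to `f`, measure the
value register, Hadamards, measure); formula of route item `FlatLawRigidity`. [cite: deWolf2019, §6.2.2 (standard algorithm for Abelian HSP)] -/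
noncomputable def cubeFourierLaw {α : Type*} [DecidableEq α] {m : ℕ} (f : (Fin m → ZMod 2) → α)
    (c : Fin m → ZMod 2) : ℝ :=
  (∑ y : Fin m → ZMod 2, ∑ y' : Fin m → ZMod 2,
      if f y = f y' then (-1 : ℝ) ^ (∑ i, (c i * (y i - y' i)).val) else 0) / (4 : ℝ) ^ m

/-- The Fourier-sampling law over `ℤ/N`, `D_f(c) = N^{-2} ∑_{y,y'} [f y = f y'] cos(2π c(y-y')/N)`
(QFT over `ℤ/N` in place of the Hadamards); formula of route item `FlatLawRigidityCyclic`. [cite: deWolf2019, §6.2.2 (standard algorithm; QFT over ℤ_q, q a power of 2)] -/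
noncomputable def cyclicFourierLaw {α : Type*} [DecidableEq α] {N : ℕ} [NeZero N] (f : ZMod N → α)
    (c : ZMod N) : ℝ :=
  (∑ y : ZMod N, ∑ y' : ZMod N,
      if f y = f y' then Real.cos (2 * Real.pi * (c * (y - y')).val / N) else 0) / (N : ℝ) ^ 2

/-- `(K, ε)`-flatness of a law `D` on a finite set: some `T` carries mass `≥ 1 - ε` and no atom
of `D` exceeds `K / |T|` (verbatim the hypothesis of route items `FlatLawRigidity[Cyclic]`;
`T = ∅` is never a witness for a probability law since then `K/|T| = 0`). [folklore] -/
def IsFlatLaw {G : Type*} [Fintype G] (K : ℕ) (ε : ℝ) (D : G → ℝ) : Prop :=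
  ∃ T : Finset G, 1 - ε ≤ ∑ c ∈ T, D c ∧ ∀ c, D c ≤ K / (T.card : ℝ)

/-! ### Structured laws: coset mixtures and Bohr-set mixtures -/

open scoped Classical in
/-- The uniform law on the coset `c₀ + W` of a subgroup `W` of a finite abelian group:
`c ↦ [c - c₀ ∈ W] / |W|` — the output law of the standard method on an instance hiding `W^⊥`
(up to the self-duality). [cite: deWolf2019, §6.2.2 (the algorithm samples uniformly from H^⊥)] -/
noncomputable def cosetUniformLaw {G : Type*} [AddCommGroup G] (W : AddSubgroup G) (c₀ c : G) : ℝ :=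
  if c - c₀ ∈ W then (1 : ℝ) / Nat.card W else 0

/-- `IsCosetMixture L M`: the law `M` on `(ℤ/2)^m` is a convex combination of at most `L` uniform
coset laws, `M = ∑_{i<L} w_i · Uniform(c_i + W_i)` (weights may vanish; conclusion of route item
`FlatLawRigidity`). [folklore] -/
def IsCosetMixture {m : ℕ} (L : ℕ) (M : (Fin m → ZMod 2) → ℝ) : Prop :=
  ∃ (w : Fin L → ℝ) (c₀ : Fin L → (Fin m → ZMod 2)) (W : Fin L → AddSubgroup (Fin m → ZMod 2)),
    (∀ i, 0 ≤ w i) ∧ ∑ i, w i = 1 ∧ ∀ c, M c = ∑ i, w i * cosetUniformLaw (W i) (c₀ i) c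

open scoped Classical in
/-- The shifted Bohr set `c₀ + Bohr(Γ, ρ) = {c : |(γ (c - c₀)).valMinAbs| ≤ ρ N for all γ ∈ Γ}` of
`ℤ/N` (frequency set `Γ`, rank `|Γ|`, radius `ρ`; the route's non-strict normalisation of
Tao–Vu's `‖γ · x‖_{ℝ/ℤ} < ρ`). [cite: TaoVu2006, Def. 4.17] -/
noncomputable def shiftedBohrSet {N : ℕ} [NeZero N] (Γ : Finset (ZMod N)) (ρ : ℝ) (c₀ : ZMod N) :
    Finset (ZMod N) :=
  univ.filter fun c => ∀ γ ∈ Γ, |((γ * (c - c₀)).valMinAbs : ℝ)| ≤ ρ * N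

/-- The uniform law on the shifted Bohr set `c₀ + Bohr(Γ, ρ)` of `ℤ/N` (zero law if the set is
empty, i.e. `ρ < 0`). Verbatim the component law of route item `FlatLawRigidityCyclic`. [cite: TaoVu2006, Def. 4.17] -/
noncomputable def bohrUniformLaw {N : ℕ} [NeZero N] (Γ : Finset (ZMod N)) (ρ : ℝ) (c₀ c : ZMod N) : ℝ :=
  if c ∈ shiftedBohrSet Γ ρ c₀ then (1 : ℝ) / (shiftedBohrSet Γ ρ c₀).card else 0

/-- `IsBohrMixture L R M`: the law `M` on `ℤ/N` is a convex combination of at most `L` uniform laws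
on shifted Bohr sets of rank at most `R` (conclusion of route item `FlatLawRigidityCyclic`). [folklore] -/
def IsBohrMixture {N : ℕ} [NeZero N] (L R : ℕ) (M : ZMod N → ℝ) : Prop :=
  ∃ (w : Fin L → ℝ) (c₀ : Fin L → ZMod N) (Γ : Fin L → Finset (ZMod N)) (ρ : Fin L → ℝ),
    (∀ i, 0 ≤ w i) ∧ ∑ i, w i = 1 ∧ (∀ i, (Γ i).card ≤ R) ∧
      ∀ c, M c = ∑ i, w i * bohrUniformLaw (Γ i) (ρ i) (c₀ i) c

/-- An admissible hidden-COSET approximant of a law `D` on `(ℤ/2)^m`: a probability law `ν` that is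
a coset mixture with at most `L` components and is `δ`-close to `D` in `ℓ¹`. [folklore] -/
def IsCosetApproximant {m : ℕ} (L : ℕ) (δ : ℝ) (D : (Fin m → ZMod 2) → ℝ)
    (ν : PMF (Fin m → ZMod 2)) : Prop :=
  IsCosetMixture L (fun c => (ν c).toReal) ∧ ∑ c, |D c - (ν c).toReal| ≤ δ

/-- An admissible hidden-BOHR-SET approximant of a law `D` on `ℤ/N`: a probability law `ν` that is
a Bohr mixture with at most `L` components of rank at most `R`, `δ`-close to `D` in `ℓ¹`. [folklore] -/
def IsBohrApproximant {N : ℕ} [NeZero N] (L R : ℕ) (δ : ℝ) (D : ZMod N → ℝ) (ν : PMF (ZMod N)) :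
    Prop :=
  IsBohrMixture L R (fun c => (ν c).toReal) ∧ ∑ c, |D c - (ν c).toReal| ≤ δ

/-! ### Queries: Fourier-sampling instances and oracle parameters -/

/-- The semantic content of a Fourier-sampling query: a register length `m`, the queried function
`f : {0,1}^m → {0,1}^*` (only its level sets matter) and the register tag (`cyclic = false`:
the group `(ℤ/2)^m`, QFT `= H^{⊗m}`; `cyclic = true`: the group `ℤ/2^m`). [cite: Shi2005, §4 (FH_k; Simon and Kitaev in FH₂)] -/
structure FSInstance where
  /-- Register length. -/
  m : ℕ
  /-- The queried function on bit vectors. -/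
  f : (Fin m → Bool) → List Bool
  /-- Register tag: `false` = `(ℤ/2)^m`, `true` = `ℤ/2^m`. -/
  cyclic : Bool

/-- A presentation of Fourier-sampling instances by query strings (e.g. Boolean circuits for `f`
plus a tag): a partial decoder. The AHC oracle takes the same instance queries as the
Fourier-sampling oracle it is compared with, so classes are parametrised by this presentation;
`nandQueryCode` is the canonical one of this file. [folklore] -/
structure FSQueryCode where
  /-- Decode a query string into an instance (`none`: malformed). -/
  decode : List Bool → Option FSInstance

namespace FSInstance

/-- The queried function transported to the group `(ℤ/2)^m` (bit `i` of `y` is `[y i = 1]`). [folklore] -/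
def cubeFn (I : FSInstance) (y : Fin I.m → ZMod 2) : List Bool :=
  I.f fun i => decide (y i = 1)

/-- The queried function transported to the group `ℤ/2^m` (little-endian bits of `y.val`). [folklore] -/
def cyclicFn (I : FSInstance) (y : ZMod (2 ^ I.m)) : List Bool :=
  I.f fun i => y.val.testBit i

end FSInstance

/-- Parameters of an AHC query, all presented in unary: flatness height `K` and `ε = 1/e`,
accuracy `δ = 1/d`, at most `L` mixture components, Bohr rank at most `R` (cyclic tag only).
[folklore] -/
structure AHCParams where
  /-- Flatness height `K`. -/
  K : ℕ
  /-- `ε = 1/e`. -/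
  e : ℕ
  /-- `δ = 1/d`. -/
  d : ℕ
  /-- Component budget. -/
  L : ℕ
  /-- Bohr-rank budget. -/
  R : ℕ

namespace AHCParams

/-- `ε = 1/e` (`e = 0` gives the junk value `ε = 0`, i.e. exact flatness). [folklore] -/
noncomputable def eps (P : AHCParams) : ℝ := 1 / P.e

/-- `δ = 1/d` (`d = 0` gives `δ = 0`, i.e. an exact structured law is demanded). [folklore] -/
noncomputable def delta (P : AHCParams) : ℝ := 1 / P.d

/-- Read the parameter block `⟨1^K, ⟨1^e, ⟨1^d, ⟨1^L, 1^R⟩⟩⟩⟩` (unary numerals paired by `boolPair`;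
total, junk-tolerant: a component of length `n` reads as `n`). [folklore] -/
def decode (w : List Bool) : AHCParams where
  K := unaryDecodeNat (boolUnpair w).1
  e := unaryDecodeNat (boolUnpair (boolUnpair w).2).1
  d := unaryDecodeNat (boolUnpair (boolUnpair (boolUnpair w).2).2).1
  L := unaryDecodeNat (boolUnpair (boolUnpair (boolUnpair (boolUnpair w).2).2).2).1
  R := unaryDecodeNat (boolUnpair (boolUnpair (boolUnpair (boolUnpair w).2).2).2).2

/-- The parameter block of `P` as a string. [folklore] -/
def encode (P : AHCParams) : List Bool :=
  boolPair (unaryEncodeNat P.K) (boolPair (unaryEncodeNat P.e) (boolPair (unaryEncodeNat P.d)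
    (boolPair (unaryEncodeNat P.L) (unaryEncodeNat P.R))))

/-- `decode (encode P) = P`. [folklore] -/
@[simp] theorem decode_encode (P : AHCParams) : decode (encode P) = P := by
  cases P
  simp [decode, encode]

end AHCParams

/-! ### Admissible answer laws -/

/-- Admissible answer laws for a CUBE-tagged instance: with `D = D_f` on `(ℤ/2)^m`, if `D` is not
`(K, ε)`-flat the answer is `⊥` (`none`) surely; if it is flat and admits a hidden-coset
approximant, the answer is a sample of one such approximant (as bits); if it is flat but admits
none, any law is admissible (promise violated). [cite: Goldreich2006, §1.2, Def. 3 (oracles conforming with a promise)] -/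
def CubeAdmissible (P : AHCParams) {m : ℕ} (f : (Fin m → ZMod 2) → List Bool)
    (μ : PMF (Option (Fin m → Bool))) : Prop :=
  (¬ IsFlatLaw P.K P.eps (cubeFourierLaw f) → μ = PMF.pure none) ∧
    (IsFlatLaw P.K P.eps (cubeFourierLaw f) →
      (∃ ν, IsCosetApproximant P.L P.delta (cubeFourierLaw f) ν) →
        ∃ ν, IsCosetApproximant P.L P.delta (cubeFourierLaw f) ν ∧
          μ = ν.map fun c => some fun i => decide (c i = 1))

/-- Admissible answer laws for a CYCLIC-tagged instance (`N = 2^m`, Bohr mixtures of rank `≤ R`),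
same three cases as `CubeAdmissible`. [cite: Goldreich2006, §1.2, Def. 3 (oracles conforming with a promise)] -/
def CyclicAdmissible (P : AHCParams) {m : ℕ} (f : ZMod (2 ^ m) → List Bool)
    (μ : PMF (Option (Fin m → Bool))) : Prop :=
  (¬ IsFlatLaw P.K P.eps (cyclicFourierLaw f) → μ = PMF.pure none) ∧
    (IsFlatLaw P.K P.eps (cyclicFourierLaw f) →
      (∃ ν, IsBohrApproximant P.L P.R P.delta (cyclicFourierLaw f) ν) →
        ∃ ν, IsBohrApproximant P.L P.R P.delta (cyclicFourierLaw f) ν ∧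
          μ = ν.map fun c => some fun i : Fin m => c.val.testBit i.val)

/-- Admissible answer laws for an instance, by register tag. [folklore] -/
def FSInstance.Admissible (I : FSInstance) (P : AHCParams) (μ : PMF (Option (Fin I.m → Bool))) :
    Prop :=
  match I.cyclic with
  | false => CubeAdmissible P I.cubeFn μ
  | true => CyclicAdmissible P I.cyclicFn μ

/-- The answer alphabet `Option {0,1}^m` as strings: `⊥ ↦ [false]`, `c ↦ true :: c`. [folklore] -/
def ahcAnswerEncode (m : ℕ) : Option (Fin m → Bool) → List Bool :=
  ((encodingBitVec m).optionBool).encode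

/-- Admissibility of the answer law `law` (on strings) to the query `w = ⟨s, params⟩` under `Q`:
malformed instance queries are answered `⊥` surely; otherwise `law` is the string image of an
admissible law for the decoded instance and parameters. [folklore] -/
def AHCQueryAdmissible (Q : FSQueryCode) (w : List Bool) (law : PMF (List Bool)) : Prop :=
  match Q.decode (boolUnpair w).1 with
  | none => law = PMF.pure (ahcAnswerEncode 0 none)
  | some I => ∃ μ : PMF (Option (Fin I.m → Bool)),
      I.Admissible (AHCParams.decode (boolUnpair w).2) μ ∧ law = μ.map (ahcAnswerEncode I.m)

/-- **The approximate-hidden-coset oracles** for the query presentation `Q`: the probabilistic,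
stateless oracles `O` (each call answered by a fresh sample of the fixed law `O w`) all of whose
answer laws are admissible — `⊥` on non-flat instances, samples of a fixed `δ`-close coset /
Bohr mixture with at most `L` components on flat ones. A relation-type (promise) oracle: a machine
"with the AHC oracle" must succeed against every member. [cite: Goldreich2006, §1.2, Def. 3 (oracles conforming with a promise)] -/
def ApproxHiddenCosetOracle (Q : FSQueryCode) : Set (List Bool → PMF (List Bool)) :=
  {O | ∀ w, AHCQueryAdmissible Q w (O w)}

/-- **`BPP^AHC` for the presentation `Q`**: languages `L` decided with error `≤ 1/3` by ONE
probabilistic polynomial-time transcript machine (`OracleAdversary`: polynomial-time step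
function, polynomial coins and round budget) against EVERY approximate-hidden-coset oracle, with
all queries of length at most the round budget (as in `PRel`). [cite: AroraBarak2009, Def. 7.3 with §3.4 (BPP^O)] -/
def BPPAHCWith (Q : FSQueryCode) : Set (Language Bool) :=
  {L | ∃ 𝒜 : OracleAdversary Bool, 𝒜.IsPPT encodingBoolBool ∧
      ∀ O ∈ ApproxHiddenCosetOracle Q, ∀ x : List Bool,
        (2 : ℝ) / 3 ≤ (𝒜.probOutputPMF O x (some (L.boolIndicator x))).toReal ∧
          ∀ t ∈ (𝒜.probTranscriptPMF O x).support, ∀ s ∈ t.1, s.length ≤ 𝒜.fuel.eval x.length}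

/-! ### The canonical query presentation: multi-output NAND straight-line programs -/

namespace NandProg

/-- Value of wire `i` on input `y ∈ {0,1}^m` given the gate values computed so far: inputs are
wires `0 … m-1`, gate `j` is wire `m + j`; dangling references read `false`. [cite: AroraBarak2009, Def. 6.1 and Rem. 6.4 (straight-line programs)] -/
def wire {m : ℕ} (y : Fin m → Bool) (vals : List Bool) (i : ℕ) : Bool :=
  if h : i < m then y ⟨i, h⟩ else vals.getD (i - m) false

/-- Gate values of a NAND straight-line program, in program order (accumulator `vals`). [cite: AroraBarak2009, Def. 6.1 and Rem. 6.4 (straight-line programs)] -/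
def gateVals {m : ℕ} (y : Fin m → Bool) : List (ℕ × ℕ) → List Bool → List Bool
  | [], vals => vals
  | (a, b) :: gs, vals => gateVals y gs (vals ++ [!(wire y vals a && wire y vals b)])

/-- The function `{0,1}^m → {0,1}^*` computed by a multi-output NAND program: evaluate the gates,
then read the output wires. [cite: AroraBarak2009, Def. 6.1 and Rem. 6.4 (straight-line programs)] -/
def eval (m : ℕ) (gates : List (ℕ × ℕ)) (outs : List ℕ) (y : Fin m → Bool) : List Bool :=
  outs.map (wire y (gateVals y gates []))

/-- Group a flat list of naturals into consecutive pairs (a trailing singleton is dropped). [folklore] -/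
def pairUp : List ℕ → List (ℕ × ℕ)
  | a :: b :: l => (a, b) :: pairUp l
  | _ => []

end NandProg

/-- The canonical presentation: `s = ⟨1^m, ⟨tag, ⟨gates, outs⟩⟩⟩` with `m` in unary, `tag = [true]`
for `ℤ/2^m` (anything else: `(ℤ/2)^m`), `gates` and `outs` lists of naturals in
`encodingListNatBool` (gate pairs flattened); undecodable lists make the query malformed. [folklore] -/
def nandQueryCode : FSQueryCode where
  decode s :=
    match encodingListNatBool.decode (boolUnpair (boolUnpair (boolUnpair s).2).2).1,
      encodingListNatBool.decode (boolUnpair (boolUnpair (boolUnpair s).2).2).2 with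
    | some gs, some outs =>
        some ⟨unaryDecodeNat (boolUnpair s).1,
          NandProg.eval _ (NandProg.pairUp gs) outs,
          decide ((boolUnpair (boolUnpair s).2).1 = [true])⟩
    | _, _ => none

/-- **`BPP^AHC`**: `BPPAHCWith` for the canonical NAND-program presentation of instances. [cite: AroraBarak2009, Def. 7.3 with §3.4 (BPP^O)] -/
def BPPAHC : Set (Language Bool) :=
  BPPAHCWith nandQueryCode

/-! ### API -/

/-- Unfolding `BPPAHCWith`. [folklore] -/
theorem mem_BPPAHCWith_iff {Q : FSQueryCode} {L : Language Bool} :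
    L ∈ BPPAHCWith Q ↔ ∃ 𝒜 : OracleAdversary Bool, 𝒜.IsPPT encodingBoolBool ∧
      ∀ O ∈ ApproxHiddenCosetOracle Q, ∀ x : List Bool,
        (2 : ℝ) / 3 ≤ (𝒜.probOutputPMF O x (some (L.boolIndicator x))).toReal ∧
          ∀ t ∈ (𝒜.probTranscriptPMF O x).support, ∀ s ∈ t.1, s.length ≤ 𝒜.fuel.eval x.length :=
  Iff.rfl

/-- Flatness is monotone in the parameters: raising `K` or `ε` keeps a law flat. [folklore] -/
theorem IsFlatLaw.mono {G : Type*} [Fintype G] {K K' : ℕ} {ε ε' : ℝ} {D : G → ℝ}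
    (h : IsFlatLaw K ε D) (hK : K ≤ K') (hε : ε ≤ ε') : IsFlatLaw K' ε' D := by
  obtain ⟨T, hT, hat⟩ := h
  refine ⟨T, by linarith, fun c => (hat c).trans ?_⟩
  exact div_le_div_of_nonneg_right (by exact_mod_cast hK) (Nat.cast_nonneg _)

/-- A uniform coset law is a probability law: `∑_c [c - c₀ ∈ W]/|W| = 1`. [folklore] -/
theorem sum_cosetUniformLaw {G : Type*} [AddCommGroup G] [Fintype G] (W : AddSubgroup G) (c₀ : G) :
    ∑ c, cosetUniformLaw W c₀ c = 1 := by
  classical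
  have hcard : (univ.filter fun c : G => c - c₀ ∈ W).card = Nat.card W := by
    rw [← SetLike.coe_sort_coe, Nat.card_eq_card_toFinset (W : Set G)]
    refine Finset.card_bij (fun c _ => c - c₀) (fun c hc => by simpa using hc)
      (fun a _ b _ h => sub_left_injective h) (fun b hb => ⟨b + c₀, by simpa using hb, by simp⟩)
  have hpos : (0 : ℝ) < Nat.card W := by exact_mod_cast Nat.card_pos
  simp only [cosetUniformLaw]
  rw [Finset.sum_ite, Finset.sum_const_zero, add_zero, Finset.sum_const, hcard, nsmul_eq_mul]
  field_simp

/-- A coset mixture is a probability law: its total mass is `∑ w_i = 1`. [folklore] -/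
theorem IsCosetMixture.sum_eq_one {m L : ℕ} {M : (Fin m → ZMod 2) → ℝ} (h : IsCosetMixture L M) :
    ∑ c, M c = 1 := by
  obtain ⟨w, c₀, W, -, hw, hM⟩ := h
  simp_rw [hM]
  rw [Finset.sum_comm]
  simp_rw [← Finset.mul_sum, sum_cosetUniformLaw, mul_one, hw]

/-- Point masses are one-component coset mixtures (cosets of the trivial subgroup) — the reason
the component budget `L` is an oracle parameter. [folklore] -/
theorem isCosetMixture_dirac {m : ℕ} (c₀ : Fin m → ZMod 2) :
    IsCosetMixture 1 fun c => if c = c₀ then 1 else 0 := by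
  classical
  refine ⟨fun _ => 1, fun _ => c₀, fun _ => ⊥, fun _ => zero_le_one, by simp, fun c => ?_⟩
  simp [cosetUniformLaw, AddSubgroup.mem_bot, sub_eq_zero]

/-- The centre lies in its shifted Bohr set when the radius is nonnegative. [cite: TaoVu2006, Def. 4.17] -/
theorem mem_shiftedBohrSet_self {N : ℕ} [NeZero N] (Γ : Finset (ZMod N)) {ρ : ℝ} (hρ : 0 ≤ ρ)
    (c₀ : ZMod N) : c₀ ∈ shiftedBohrSet Γ ρ c₀ := by
  simp [shiftedBohrSet, mul_nonneg hρ (Nat.cast_nonneg N)]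

/-- A uniform Bohr law of nonnegative radius is a probability law. [folklore] -/
theorem sum_bohrUniformLaw {N : ℕ} [NeZero N] (Γ : Finset (ZMod N)) {ρ : ℝ} (hρ : 0 ≤ ρ)
    (c₀ : ZMod N) : ∑ c, bohrUniformLaw Γ ρ c₀ c = 1 := by
  classical
  have hpos : (0 : ℝ) < (shiftedBohrSet Γ ρ c₀).card := by
    exact_mod_cast Finset.card_pos.2 ⟨c₀, mem_shiftedBohrSet_self Γ hρ c₀⟩
  simp only [bohrUniformLaw]
  rw [Finset.sum_ite, Finset.sum_const_zero, add_zero, Finset.sum_const, Finset.filter_mem_eq_inter,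
    Finset.univ_inter, nsmul_eq_mul]
  field_simp

/-- Every instance and parameter block admits an admissible answer law: `⊥` if not flat, an
approximant's sample if one exists, otherwise anything. [folklore] -/
theorem FSInstance.exists_admissible (I : FSInstance) (P : AHCParams) : ∃ μ, I.Admissible P μ := by
  unfold FSInstance.Admissible
  cases I.cyclic
  · by_cases hf : IsFlatLaw P.K P.eps (cubeFourierLaw I.cubeFn)
    · by_cases hν : ∃ ν, IsCosetApproximant P.L P.delta (cubeFourierLaw I.cubeFn) ν
      · obtain ⟨ν, hν⟩ := hν
        exact ⟨_, fun h => (h hf).elim, fun _ _ => ⟨ν, hν, rfl⟩⟩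
      · exact ⟨PMF.pure none, fun h => (h hf).elim, fun _ h => (hν h).elim⟩
    · exact ⟨PMF.pure none, fun _ => rfl, fun h => (hf h).elim⟩
  · by_cases hf : IsFlatLaw P.K P.eps (cyclicFourierLaw I.cyclicFn)
    · by_cases hν : ∃ ν, IsBohrApproximant P.L P.R P.delta (cyclicFourierLaw I.cyclicFn) ν
      · obtain ⟨ν, hν⟩ := hν
        exact ⟨_, fun h => (h hf).elim, fun _ _ => ⟨ν, hν, rfl⟩⟩
      · exact ⟨PMF.pure none, fun h => (h hf).elim, fun _ h => (hν h).elim⟩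
    · exact ⟨PMF.pure none, fun _ => rfl, fun h => (hf h).elim⟩

/-- **Non-vacuity**: every presentation has an approximate-hidden-coset oracle. [folklore] -/
theorem approxHiddenCosetOracle_nonempty (Q : FSQueryCode) : (ApproxHiddenCosetOracle Q).Nonempty := by
  have key : ∀ w, ∃ law, AHCQueryAdmissible Q w law := by
    intro w
    unfold AHCQueryAdmissible
    cases Q.decode (boolUnpair w).1 with
    | none => exact ⟨_, rfl⟩
    | some I =>
      obtain ⟨μ, hμ⟩ := I.exists_admissible (AHCParams.decode (boolUnpair w).2)
      exact ⟨_, μ, hμ, rfl⟩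
  choose O hO using key
  exact ⟨O, hO⟩

end Literature.Computability.QuantumComplexity
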